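import Summits.AtomisticToContinuum.FouriersLaw.Theorems.EmbeddedDrudeMourreEngineGlue
import Summits.AtomisticToContinuum.FouriersLaw.Theorems.EmbeddedDrudeMourreFGRGap
import HarnessLib

/-!
# `DrudeDissolution ⇐ MourreDissolution`, unconditionally (`--supports` stmt-AtomisticToContinuum-12593)

Crux `Summit.AtomisticToContinuum.FouriersLaw.Theses.EmbeddedDrudeMourre.DrudeDissolution`
(stmt-AtomisticToContinuum-12593, the route's target: the dissolved Drude atom of the low-temperature
pinned anharmonic chain) is, by the route's design, the OUTPUT of the engine
`FGRGap → MourreDissolution → DrudeDissolution` (`EngineGlue`, stmt-12600, proved as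
`Theorems.EmbeddedDrudeMourre.engineGlue_proof`). Since the odd-sector gap `FGRGap` (stmt-12595) is now
PROVED in the tree (`Theorems.FGRGap_proof`, line fold-jet-rigidity), the target follows from the
conditional engine `MourreDissolution` (stmt-AtomisticToContinuum-12594) ALONE, with no hypothesis left:
this file records that one-line modus ponens, so that a proof `h` of `MourreDissolution` closes
stmt-12593 by `drudeDissolution_of_mourreDissolution h` (a CONDITIONAL result: it closes nothing by
itself).
-/

namespace Summit.AtomisticToContinuum.FouriersLaw.Theorems.DrudeDissolution

open Summit.AtomisticToContinuum.FouriersLaw.Theses.EmbeddedDrudeMourre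

/-- **`MourreDissolution → DrudeDissolution`** (no other hypothesis): the gap hypothesis
`HasOddSectorGap ω₂ lam β` of the conditional engine is discharged at every `ω₂, lam, β > 0` by the
proved crux `FGRGap` (`Theorems.FGRGap_proof`), and the two conclusions are syntactically identical
(`Theorems.EmbeddedDrudeMourre.engineGlue_proof`). [folklore] -/
theorem drudeDissolution_of_mourreDissolution :
    Summit.AtomisticToContinuum.FouriersLaw.Theses.EmbeddedDrudeMourre.MourreDissolution →
      Summit.AtomisticToContinuum.FouriersLaw.Theses.EmbeddedDrudeMourre.DrudeDissolution :=
  fun h => EmbeddedDrudeMourre.engineGlue_proof FGRGap_proof h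

end Summit.AtomisticToContinuum.FouriersLaw.Theorems.DrudeDissolution
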